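import Literature.MathematicalPhysics.QuantumFieldTheory.Balaban1983to89.B9Thm34HolderRightG

/-!
# `Balaban1983to89.B9Thm34HolderAllFinal` — [Balaban1985BackgroundPropagators] THEOREM 3.4 p. 400 × THEOREMS 3.1/3.3: ALL FOUR SUP-HÖLDER MEMBERS
# OF (3.43) («‖ζ∇_UG′λ‖_β, ‖ζG′∇*_Uλ‖_β» and Theorem 3.3's «‖ζ∇_UGJ‖_β, ‖ζG∇*_UJ‖_β») FOR THE EXTENDED OPERATORS `G′(U′U)`, `G(U′U)` AT THE
# FINAL LEVEL OF FILE 28 — one threshold `a₁`, one constant `B` — FILE 36 of the Sect. B programme of cell `lit-balaban`, seat r06 gen 18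

statement-level skeleton of published theorems with citation tags; proofs where landed; nothing here is a claim about the Yang–Mills mass gap

CITATION HEADER (lean-in-tree rule).  B9 = T. Bałaban, *Propagators for lattice gauge theories in a background field*, Commun. Math. Phys. **99** (1985)
389–434 [Balaban1985BackgroundPropagators] (doi 10.1007/bf01240355; `paper:balaban1985-cmp99-background-propagators`, journal page = PDF page + 388):
Theorem 3.4 p. 400 [PDF 12] L7–10 («There exists a positive constant a₁ such that the operators G′(U), (Q′(U)G′²(U)Q′*(U))⁻¹, R(U), G(U) extend to
configurations U′U for α₁ ≦ a₁ as analytic functions of A. The extended operators satisfy all the inequalities of Theorems 3.1–3.3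
correspondingly»), Theorem 3.1 (3.40) p. 397 and (3.42)–(3.43) pp. 397–398 [PDF 9–10] (the two Hölder members of (3.43): «‖ζ∇_UG′λ‖_β,
‖ζG′∇*_Uλ‖_β ≦ B₀(β₀)(Lʲη)^{1−β}(‖ζ‖_β^ξ + |ζ|)e^{−δ₀d(y,y′)}|λ|» and the remark «the choice of derivatives ∇_U, ∇*_U is conventional»), Theorem 3.3
p. 399 [PDF 11] («with G′(U) replaced by G(U) and λ replaced by a function J defined at bonds of the lattice»), (3.62)–(3.65) pp. 402–403, p. 403
l. 1–9, (3.76)–(3.77) pp. 405–406, (3.82)–(3.86) p. 407 [PDF 19] («Thus Theorem 3.4 is proved, assuming that Theorems 3.1–3.3 hold»); «for α₁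
sufficiently small» p. 402, «of course with different constants» p. 403.  [4] = T. Bałaban, *Propagators and renormalization transformations for
lattice gauge theories. II*, Commun. Math. Phys. **96** (1984) 223–250 [Balaban1984PropagatorsII], (2.51)–(2.55) p. 232, Lemma 2.1 p. 234.  Pages
re-read by this seat (r06 gen 18) as text `p0009`–`p0012`, `p0014`–`p0015`, `p0019` of the held paper.  Cell `lit-balaban`, seat r06 (B9 fold owner)
gen 18, FILE 36; SKELETON rows **B9.Thm3.4** × B9.Thm3.1 × B9.Thm3.3 ((3.43) cells) × B9.Eq3.65 × B9.Eq3.85 (cells); no row head changes.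

WHY THIS FILE (B9-CLOSURE §5 item 3 (M′)).  After FILES 34/35 the four sup-Hölder members of (3.43) for the extended operators were theorems at
two different levels: the left-derivative members of `G′(U′U)` and `G(U′U)` and the right-derivative member of `G′(U′U)` at the FINAL level of
FILE 28 `B9Thm34AllFinal.thm34_all_final` (printed quantifiers `∃ a₁ > 0 ∃ B ∀ α₁ ≦ a₁ ∀ A ∈ (3.37)`; FILE 34 §5, §6), the right-derivative
member of `G(U′U)` only at the DEVICE level of gen 11 (FILE 35 `B9Thm34HolderRightG.thm34_G_holderRight_concreteV₃`: abstract `P₁`, `P₂`,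
`D′R′D′*`, explicit smallness hypotheses).  This file puts ALL FOUR at the final level in ONE statement with ONE threshold and ONE constant:
* **`thm34_all_holder_final`** — HYPOTHESES = FILE 34 §5 `thm34_all_holderLeft_final` VERBATIM (= FILE 28's + `0 < B₀`).  CONCLUSION
  `∃ a₁ > 0 ∃ B ≧ 0 ∀ α₁ ≦ a₁ ∀ A …` (FILE 28's premises verbatim): (i) `G′(U′U)` = the two-sided inverse of `Δ′_a(U) − V′(A)` with its
  Hölder-LEFT transfer (FILE 34 §5, re-exported) and (i′) its Hölder-RIGHT member (FILE 34 §6 `thm34_Gp_holderRight_final` under the common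
  threshold); `∃ C⁻¹(U′U), G(U′U)` — THE SAME PAIR AS FILE 28's ((ii)/(iii) re-exported defining identities) — with (iii) the Hölder-LEFT
  transfer for `G(U′U)` (FILE 34 §5) and (iv) NEW: THE HÖLDER-RIGHT MEMBER FOR THIS `G(U′U)`: for every right letter `D_s` with Theorem 3.3's
  entry `G(U)D_s ≺ B₀Lʲηe^{−δ₀d}`, every `ℝ`-linear `𝔸`-valued functional `Φ` of the bond function (a transported Hölder quotient (3.40), FILE
  34 §3), every anchor `y ∋ p₀`, `γ`, `B_h, c_ζ ≧ 0`: (a) `‖Φ(G(U)J)‖ ≦ B_h(Lʲη)^{2−γ}c_ζe^{−δ₀d(y,y′)}|J|`, (b) `‖Φ(G(U)∇_kJ)‖ ≦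
  B_h(Lʲη)^{1−γ}c_ζe^{−δ₀d}|J|` (`2d` concrete difference letters), (c) the same for `G(U)D_s` ⟹ `‖Φ(G(U′U)D_sJ)‖ ≦
  B·B_h(Lʲη)^{1−γ}c_ζe^{−(δ₀/6)d(y,y′)}|J|`.
PROOF OF (iv) (the re-threading announced in B9-CLOSURE v2.0 addendum 2, done by UNIQUENESS instead of re-opening FILES 16–28): inside the
`∀`-context, (1) FILE 25 §3 `B9Thm34GKernelFinal.exists_threshold_pOne` delivers a `C⁻¹(U′U)` with (3.77) for the concrete `P₁(A)` of (3.76)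
(`κ₁ := K` independent of `α₁`, rate `δ₀/5`); it coincides with FILE 28's `C⁻¹(U′U)` (`left_inv_eq_right_inv`); (2) (3.83) for the printed `P₂(A)`
(`B9Ineq385VG.ineq383_op`, `κ₂ := κ₃₈₃(α₁)`), (3.76) for the concrete letters (`B9Eq376POneLetters.eq376_concrete`), Theorem 3.3's letters
weakened to the rate `δ₀/5` (`hasMajorant_rate_mono`); (3) FILE 35 `thm34_G_holderRight_concreteV₃` at FILE 20's cascade (`δ = δ₀/5`, `ρ =
9δ₀/50`, exponents `1/100`, target `δ₀/6 ≦ (1 − 3/100)ρ`), its smallness `κ₃₈₅(…)α₁c₁ < 1` and the bound `B(α₁) ≦ K_B` of its clause constant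
obtained below a threshold by CONTINUITY AT `α₁ = 0` (`exists_threshold_of_continuousAt`, `exists_bound_of_continuousAt` — «for α₁ sufficiently
small», «of course with different constants»); (4) the `G(U′U)` it returns is a two-sided inverse of the SAME concrete `Δ_a(U′U)` as FILE 28's,
hence EQUAL to it (`left_inv_eq_right_inv`), and its clause is (iv).  `a₁ = min(…)` of the five thresholds, `B = B₃₄ + B₃₄′ + K_B`.

HONEST SCOPE.  (a) Exactly as FILES 34/35: Theorem 3.1/3.3 for `U` enter per functional as the hypotheses (a)–(c) of each clause (input (a) is
the (3.40) quotient of `ζG(U)J` itself — in print a consequence of (3.42)₂, here an input); `Φ` is an arbitrary linear functional — the metric,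
contours, transport `R(U(Γ))` and cut-off `ζ` of (3.40) decide which `Φ`, `γ`, `B_h`, `c_ζ` the user feeds (FILE 34 §3 `holderQuot340_apply`);
derivative and transport of `U` on both sides (p. 398 «conventional»).  (b) What this file adds is (iv) at the final level and the common
threshold; (i)–(iii) are FILE 34's, re-exported so that ONE name carries all four (3.43) members.  (c) NOT covered anywhere yet: the
input-side Hölder norms (3.44)–(3.45), the `L²` members (3.46) (B9-CLOSURE §5 item 3 (N)/(O)); (3.47) for the extended operators follows from
(3.42) by `B9Ineq347AllEntries` (p27) and is not restated.  (d) No new definition, no new named fact; no row head changes (B9.Thm3.4 stays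
`typed-existing`: the printed theorem at a general regular background rests on Theorems 3.1–3.3, B9-CLOSURE §3 item 1).

Depends on: `B9Thm34HolderLeftFinal` (FILE 34: `thm34_all_holderLeft_final`, `thm34_Gp_holderRight_final`), `B9Thm34HolderRightG` (FILE 35:
`thm34_G_holderRight_concreteV₃`), `B9Thm34GKernelFinal` (`exists_threshold_pOne`, `exists_bound_of_continuousAt`), `B9Thm34GFinal`
(`exists_threshold_of_continuousAt`, `ineq261_rescale`, `scaleTransfer_rescale`, `c1_pos_of_ineq261`), `B9Ineq385VG` (`ineq383_op`, `kappa383`,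
`kappa385`), `B9Eq376POneLetters` (`eq376_concrete`), `B9Ineq366CPrime` (`hasMajorant_rate_mono`), `B9Ineq385Kernel` (`exp_rate_mono`), Mathlib
`left_inv_eq_right_inv` — all used BY NAME.
-/

noncomputable section

namespace Literature.MathematicalPhysics.QuantumFieldTheory.Balaban1983to89.B9Thm34HolderAllFinal

open NormedSpace Complex
open Literature.MathematicalPhysics.QuantumFieldTheory.Balaban1983to89
open Literature.MathematicalPhysics.QuantumFieldTheory.Balaban1983to89.B6RandomWalk (HasMajorant BlockSupp hasMajorant_mono Triangle254 Ineq261)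
open Literature.MathematicalPhysics.QuantumFieldTheory.Balaban1983to89.B6RandomWalkHom (HasMajorantHom)
open Literature.MathematicalPhysics.QuantumFieldTheory.Balaban1983to89.B6RandomWalkKernel (HasKernelBound)
open Literature.MathematicalPhysics.QuantumFieldTheory.Balaban1983to89.B6RandomWalkSection (secExt secRes secConj)
open Literature.MathematicalPhysics.QuantumFieldTheory.Balaban1983to89.B9Thm34Ext (toB6)
open Literature.MathematicalPhysics.QuantumFieldTheory.Balaban1983to89.B9Ineq347 (ScaleTransfer)
open Literature.MathematicalPhysics.QuantumFieldTheory.Balaban1983to89.B9Eq386Neumann (pTwo deltaA)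
open Literature.MathematicalPhysics.QuantumFieldTheory.Balaban1983to89.B9Eq39Adjoint
open Literature.MathematicalPhysics.QuantumFieldTheory.Balaban1983to89.B9Eq369Small (Through)
open Literature.MathematicalPhysics.QuantumFieldTheory.Balaban1983to89.B9Eq372Locality (stBonds)
open Literature.MathematicalPhysics.QuantumFieldTheory.Balaban1983to89.B9Eq352DivForm (tauF tauB)
open Literature.MathematicalPhysics.QuantumFieldTheory.Balaban1983to89.B9Eq352DivFormLetters
open Literature.MathematicalPhysics.QuantumFieldTheory.Balaban1983to89.B9Eq352GradLetters (diffLetter)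
open Literature.MathematicalPhysics.QuantumFieldTheory.Balaban1983to89.B9Eq371GradLetters (bT bU)
open Literature.MathematicalPhysics.QuantumFieldTheory.Balaban1983to89.B9Eq372RemLetters (lapDDLetter)
open Literature.MathematicalPhysics.QuantumFieldTheory.Balaban1983to89.B9Eq382V3Letters (dPrimeLetter)
open Literature.MathematicalPhysics.QuantumFieldTheory.Balaban1983to89.B9Eq376POneLetters (conjHom gradLin divLin eq376_concrete)
open Literature.MathematicalPhysics.QuantumFieldTheory.Balaban1983to89.B9Eq360Vprime (gPrimeExtEnd)
open Literature.MathematicalPhysics.QuantumFieldTheory.Balaban1983to89.B9Eq360VprimeLetters (vPrimeConc)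
open Literature.MathematicalPhysics.QuantumFieldTheory.Balaban1983to89.B9Ineq385VG (kappa383 kappa383_nonneg kappa385 kappa385_nonneg ineq383_op)
open Literature.MathematicalPhysics.QuantumFieldTheory.Balaban1983to89.B9Ineq385V3Concrete (cV385)
open Literature.MathematicalPhysics.QuantumFieldTheory.Balaban1983to89.B9Ineq385Kernel (exp_rate_mono)
open Literature.MathematicalPhysics.QuantumFieldTheory.Balaban1983to89.B9Ineq366CPrime (hasMajorant_rate_mono)
open Literature.MathematicalPhysics.QuantumFieldTheory.Balaban1983to89.B9Thm34GFinal (exists_threshold_of_continuousAt ineq261_rescale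
  scaleTransfer_rescale c1_pos_of_ineq261)
open Literature.MathematicalPhysics.QuantumFieldTheory.Balaban1983to89.B9Thm34GKernelFinal (exists_threshold_pOne exists_bound_of_continuousAt)
open Literature.MathematicalPhysics.QuantumFieldTheory.Balaban1983to89.B9Thm34HolderLeftFinal (thm34_all_holderLeft_final thm34_Gp_holderRight_final)
open Literature.MathematicalPhysics.QuantumFieldTheory.Balaban1983to89.B9Thm34HolderRightG (thm34_G_holderRight_concreteV₃)

/-! ## §1  Bookkeeping: weakening the constant and the input rate of a (3.43)-type bound -/

section Bookkeeping

/-- «of course with different constants» (p. 403): a (3.43)-type bound with constant `B` implies the one with any `B′ ≧ B` (the other factors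
`B_h, (Lʲη)^{1−β}, c_ζ, e^{−ρd}, |λ|` being non-negative). [cite: Balaban1985BackgroundPropagators, (3.43) p.398 + p.403 (bookkeeping ours)] -/
theorem holderBound_const_mono {x B B' Bh L c E M : ℝ} (h : B ≤ B') (hBh : 0 ≤ Bh) (hL : 0 ≤ L) (hc : 0 ≤ c) (hE : 0 ≤ E) (hM : 0 ≤ M)
    (hx : x ≤ B * Bh * L * c * E * M) : x ≤ B' * Bh * L * c * E * M := by
  have hX : 0 ≤ Bh * L * c * E * M := mul_nonneg (mul_nonneg (mul_nonneg (mul_nonneg hBh hL) hc) hE) hM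
  calc x ≤ B * Bh * L * c * E * M := hx
    _ = B * (Bh * L * c * E * M) := by ring
    _ ≤ B' * (Bh * L * c * E * M) := mul_le_mul_of_nonneg_right h hX
    _ = B' * Bh * L * c * E * M := by ring

/-- An input of (3.43)-type at the printed rate `δ₀` is an input at any slower rate `ρ ≦ δ₀` (`e^{−δ₀d} ≦ e^{−ρd}` for `d ≧ 0`).
[cite: Balaban1985BackgroundPropagators, (3.43) p.398 + p.403 (bookkeeping ours)] -/
theorem holderBound_rate_mono {x Bh L c C δ₀ ρ t : ℝ} (hρ : ρ ≤ δ₀) (ht : 0 ≤ t) (hBh : 0 ≤ Bh) (hL : 0 ≤ L) (hc : 0 ≤ c) (hC : 0 ≤ C)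
    (hx : x ≤ Bh * L * c * Real.exp (-(δ₀ * t)) * C) : x ≤ Bh * L * c * Real.exp (-(ρ * t)) * C :=
  hx.trans (mul_le_mul_of_nonneg_right (mul_le_mul_of_nonneg_left (exp_rate_mono hρ ht) (mul_nonneg (mul_nonneg hBh hL) hc)) hC)

end Bookkeeping

/-! ## §2  THEOREM 3.4: ALL FOUR SUP-HÖLDER MEMBERS OF (3.43) FOR `G′(U′U)` AND FOR THE `G(U′U)` OF FILE 28, ONE THRESHOLD, ONE CONSTANT -/

section All

variable {𝔸 : Type*} [NormedRing 𝔸] [NormedAlgebra ℂ 𝔸] [CompleteSpace 𝔸] {ι : Type} [Fintype ι]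
variable (b : Module.Basis ι ℝ 𝔸) {S : Type} {κ : Type} [Fintype κ] [LinearOrder κ]
variable (T : κ → Equiv.Perm S) (U : κ → S → 𝔸ˣ)
variable {g : B9.Geometry} [Fintype g.Site] {Rr : ℝ} {H : Prop}

set_option maxHeartbeats 1600000 in
/-- **THEOREM 3.4 × THEOREMS 3.1/3.3: ALL FOUR SUP-HÖLDER MEMBERS OF (3.43) FOR THE EXTENDED OPERATORS, AT THE FINAL LEVEL** («‖ζ∇_UG′λ‖_β,
‖ζG′∇*_Uλ‖_β ≦ B₀(β₀)(Lʲη)^{1−β}(‖ζ‖_β^ξ + |ζ|)e^{−δ₀d(y,y′)}|λ|», (3.43) p. 398; Theorem 3.3 p. 399 for `G(U)` «with λ replaced by J»; for `U′U`: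
«The extended operators satisfy all the inequalities of Theorems 3.1–3.3 correspondingly», Theorem 3.4 p. 400).  HYPOTHESES = FILE 34 §5
`thm34_all_holderLeft_final` VERBATIM (= FILE 28 `thm34_all_final` + `0 < B₀`).  CONCLUSION `∃ a₁ > 0 ∃ B ≧ 0 ∀ α₁ ≦ a₁ ∀ A …` (FILE 28's premises
verbatim): (i) `G′(U′U)` is the two-sided inverse of `Δ′_a(U) − V′(A)` with its Hölder-LEFT transfer at `(B, 9δ₀/10)` (FILE 34 §5) and (i′) its
Hölder-RIGHT member at `(B, 9δ₀/10)` for every right letter `D` with `G′(U)D ≺ B_GLʲηe^{−δ₀d}` (FILE 34 §6); `∃ C⁻¹(U′U), G(U′U)` — the same pair as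
FILE 28's: (ii) `C⁻¹(U′U)` the two-sided inverse of `Q′(U′U)G′²(U′U)Q′*(U′U)`, (iii) `G(U′U)` the two-sided inverse of the concrete `Δ_a(U′U)` with
its Hölder-LEFT transfer at `(B, δ₀/6)` (FILE 34 §5), and (iv) NEW: its Hölder-RIGHT member at `(B, δ₀/6)` — for every right letter `D_s` with
Theorem 3.3's entry `G(U)D_s ≺ B₀Lʲηe^{−δ₀d}`, every `ℝ`-linear `𝔸`-valued `Φ`, anchor `y ∋ p₀`, `γ`, `B_h, c_ζ ≧ 0`: (a) `‖Φ(G(U)J)‖ ≦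
B_h(Lʲη)^{2−γ}c_ζe^{−δ₀d(y,y′)}|J|`, (b) `‖Φ(G(U)∇_kJ)‖ ≦ B_h(Lʲη)^{1−γ}c_ζe^{−δ₀d}|J|` (`k ∈ κ ⊕ κ`), (c) the same for `G(U)D_s` ⟹
`‖Φ(G(U′U)D_sJ)‖ ≦ B·B_h(Lʲη)^{1−γ}c_ζe^{−(δ₀/6)d(y,y′)}|J|`.  PROOF: module header ((iv) by FILE 35 at FILE 20's cascade + FILE 25 §3's (3.77) +
uniqueness of the two-sided inverses `C⁻¹(U′U)`, `G(U′U)`; thresholds and the clause constant by continuity at `α₁ = 0`).  HONEST SCOPE: module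
header (a)–(d).
[cite: Balaban1985BackgroundPropagators, Thm 3.4 p.400 + Thm 3.1 (3.40)/(3.42)–(3.43) pp.397–398 + Thm 3.3 p.399 + (3.62)–(3.65) pp.402–403 + p.403 l.1–9 + (3.76)–(3.77) pp.405–406 + (3.82)–(3.86) p.407 + (3.37)/(3.35) p.396; Balaban1984PropagatorsII, (2.51)–(2.55) p.232 + Lemma 2.1 p.234; Balaban1985Variational, (135) p.298] -/
theorem thm34_all_holder_final [Fintype S] [DecidableEq S] [DecidableEq ι] [DecidableEq g.Site] [Nonempty g.Site] (blk : S → g.Site) (d : ℕ)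
    (δ₀ B₀ κQ BG B₁ cF Cq a₀ C₀ d₀ M₂ κQb cFb abar : ℝ)
    (kQ : g.Site → S → 𝔸 →L[ℝ] 𝔸) (sQ : S → 𝔸 →L[ℝ] 𝔸) (cfun w : g.Site → ℝ)
    (hB₀ : 0 ≤ B₀) (hκQ : 0 < κQ) (hBG : 0 < BG) (hB₁ : 0 < B₁) (hcF : 0 < cF) (hCq : 0 ≤ Cq) (ha₀ : 0 ≤ a₀) (hC₀ : 0 ≤ C₀)
    (hM₂ : 0 ≤ M₂) (hδ₀ : 0 < δ₀) (hκQb : 0 ≤ κQb) (hcFb : 0 ≤ cFb) (habar : 0 ≤ abar)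
    -- the multiscale geometry 𝔅 (p. 393, [4] (2.1)–(2.4)) and its axioms
    (hdnn : ∀ a a' : g.Site, 0 ≤ g.dist a a') (htri : Triangle254 (toB6 g Rr H)) (hrefl : ∀ y : g.Site, g.dist y y = 0)
    (hsym : ∀ y y' : g.Site, g.dist y y' = g.dist y' y) (hlen : ∀ y : g.Site, 0 < g.len y) (hlenη : ∀ y : g.Site, g.eta ≤ g.len y)
    (hη : 0 < g.eta) (hL : 1 ≤ g.L)
    -- [4] Lemma 2.1 (2.61) at the rate `δ₀`, «for every 0 < α < 1»
    (h261 : ∀ α : ℝ, 0 < α → α < 1 → Ineq261 d (toB6 g Rr H) δ₀ α)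
    -- p. 398: «Using Lemma 2.1 in [4] we may replace the factor (Lʲη)^α by (Lʲη)^β(L^{j′}η)^γ with β + γ = α» — for every exponent, one
    -- constant `Λ(α) ≧ 1` for the six weights `(Lʲη)^{1,2,−1,−2,−4}` (natural and real powers)
    (hST : ∀ α : ℝ, 0 < α → ∃ Λ : ℝ, 1 ≤ Λ ∧ ScaleTransfer g δ₀ α Λ (fun a => g.len a) ∧ ScaleTransfer g δ₀ α Λ (fun a => g.len a ^ 2) ∧
      ScaleTransfer g δ₀ α Λ (fun a => (g.len a)⁻¹) ∧ ScaleTransfer g δ₀ α Λ (fun a => (g.len a ^ 2)⁻¹) ∧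
      ScaleTransfer g δ₀ α Λ (fun a => (g.len a ^ 4)⁻¹) ∧ ScaleTransfer g δ₀ α Λ (fun y => g.len y ^ (-(4 : ℝ))))
    -- real coordinates of `𝔸`, commuting translations, unitary-type background
    (hrepr : ∀ (v : 𝔸) (i : ι), |b.repr v i| ≤ M₂ * ‖v‖) (hT : ∀ (μ ν : κ) (x : S), T μ (T ν x) = T ν (T μ x))
    (hU1 : ∀ m z, ‖((U m z : 𝔸ˣ) : 𝔸)‖ ≤ 1 ∧ ‖(((U m z)⁻¹ : 𝔸ˣ) : 𝔸)‖ ≤ 1)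
    -- (3.35) on the plaquettes through each bond, at that bond's block scale; stencil geometry at range `d₀`
    (h35 : ∀ μ x m n y, Through T μ x m n y → ‖(plaqU T U m n y : 𝔸) - 1‖ ≤ C₀ * ((g.L ^ g.scale (blk x))⁻¹) ^ 2)
    (hd₀B : ∀ μ x, g.dist (blk x) (blk ((T μ).symm x)) ≤ d₀) (hd₀F : ∀ μ x, g.dist (blk x) (blk (T μ x)) ≤ d₀)
    (hd₀FB : ∀ μ ν x, g.dist (blk x) (blk ((T ν).symm (T μ x))) ≤ d₀)
    (hd₀st : ∀ μ x (q : κ × S), q ∈ stBonds T μ x → g.dist (blk x) (blk q.2) ≤ d₀)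
    (hd₀loc : ∀ μ x (q : κ × S), q ∈ B9Eq375Locality.locBondsA' T μ x → g.dist (blk x) (blk q.2) ≤ d₀)
    (hd₀0 : ∀ y : g.Site, g.dist y y ≤ d₀)
    -- the `A`-independent data of the concrete `V′(A)` of (3.60): (3.19) kernels/multipliers and the `a`-weights of (3.24)
    (hw : ∀ y, 0 ≤ w y) (hcard : ∀ y, ((B9Eq360Vprime.block blk y).card : ℝ) * w y ≤ 1)
    (hkQ : ∀ y x, blk x = y → ‖kQ y x‖ ≤ w y) (hsQ : ∀ x, ‖sQ x‖ ≤ 1) (hcfun : ∀ y, |cfun y| ≤ a₀ * (g.len y ^ 2)⁻¹)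
    -- THEOREM 3.1 for `G′(U)`: (3.42)₁,₂,₃ at the rate `δ₀`
    {Gp : Module.End ℝ (S × ι → ℝ)}
    (h342_1 : HasMajorant (g := toB6 g Rr H) (fun p : S × ι => blk p.1) Gp
      (fun a a' => BG * g.len a ^ 2 * Real.exp (-(δ₀ * g.dist a a'))))
    (h342_2 : ∀ k : κ ⊕ κ, HasMajorant (g := toB6 g Rr H) (fun p : S × ι => blk p.1)
      (conj b (diffLetter T U ((g.eta : ℂ)⁻¹) k) * Gp) (fun a a' => BG * g.len a * Real.exp (-(δ₀ * g.dist a a'))))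
    (h342_3 : ∀ k : κ ⊕ κ, HasMajorant (g := toB6 g Rr H) (fun p : S × ι => blk p.1)
      (Gp * conj b (diffLetter T U ((g.eta : ℂ)⁻¹) k)) (fun a a' => BG * g.len a * Real.exp (-(δ₀ * g.dist a a'))))
    -- (3.24): `G′(U) = (Δ′_a(U))⁻¹` for the letter `Δ′_a(U)`
    {Δp : Module.End ℝ (S × ι → ℝ)} (hΔpGp : Δp * Gp = 1) (hGpΔp : Gp * Δp = 1)
    -- the (3.19) letters `Q′(U)`, `Q′*(U)` in their own typing with block-local two-space majorants, a section of the block map (FILE 17)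
    (rep : g.Site → S × ι) (hrep : ∀ y : g.Site, blk (rep y).1 = y)
    {Qc : (S × ι → ℝ) →ₗ[ℝ] (g.Site → ℝ)} {Qcs : (g.Site → ℝ) →ₗ[ℝ] (S × ι → ℝ)} {Linv : Module.End ℝ (g.Site → ℝ)}
    (hQc : HasMajorantHom (g := toB6 g Rr H) (fun p : S × ι => blk p.1) (fun y : g.Site => y) Qc
      (fun a a' : g.Site => κQ * (if a = a' then (1 : ℝ) else 0)))
    (hQcs : HasMajorantHom (g := toB6 g Rr H) (fun y : g.Site => y) (fun p : S × ι => blk p.1) Qcs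
      (fun a a' : g.Site => κQ * (if a = a' then (1 : ℝ) else 0)))
    -- THEOREM 3.2 for `U`: (3.21) `C⁻¹ = (Q′G′²Q′*)⁻¹` exists (`hLinv`) with the KERNEL bound (3.48) at the rate `δ₀`
    (hLinv : (Qc ∘ₗ (Gp * Gp) ∘ₗ Qcs) * Linv = 1)
    (h348 : ∀ y y' : g.Site, |B9Thm34Inv.ker (B9Thm34Inv.vol g d) Linv y y'| ≤
      B₁ * g.len y ^ (-(4 : ℝ)) * g.len y' ^ (-(d : ℝ)) * Real.exp (-(δ₀ * g.dist y y')))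
    -- the (3.15) bond letters `Q(U)`, `Q*(U)` and the weight letter `a` of (3.24)/(3.26), with their majorants
    {G Qs Q a : Module.End ℝ ((κ × S) × ι → ℝ)}
    (hQb : HasMajorant (g := toB6 g Rr H) (fun q : (κ × S) × ι => blk q.1.2) Q (fun a a' => κQb * Real.exp (-(δ₀ * g.dist a a'))))
    (hQsb : HasMajorant (g := toB6 g Rr H) (fun q : (κ × S) × ι => blk q.1.2) Qs (fun a a' => κQb * Real.exp (-(δ₀ * g.dist a a'))))
    (ha324 : HasMajorant (g := toB6 g Rr H) (fun q : (κ × S) × ι => blk q.1.2) a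
      (fun a a' : g.Site => if a = a' then abar * (g.len a ^ 2)⁻¹ else 0))
    -- THEOREM 3.3 for `G(U)`: two-sided inverse of the concrete `Δ_a(U)` and its (3.42)-entries at the rate `δ₀`
    (hΔG : deltaA (conj b (lapDDLetter T ((g.eta : ℂ)⁻¹) U)) (conj b (dPrimeLetter T U g.eta))
      (conjHom b (gradLin T ((g.eta : ℂ)⁻¹) U) ∘ₗ (1 - (Gp ∘ₗ Qcs ∘ₗ Linv ∘ₗ Qc ∘ₗ Gp)) ∘ₗ conjHom b (divLin T ((g.eta : ℂ)⁻¹) U)) Qs a Q * G = 1)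
    (hGΔ : G * deltaA (conj b (lapDDLetter T ((g.eta : ℂ)⁻¹) U)) (conj b (dPrimeLetter T U g.eta))
      (conjHom b (gradLin T ((g.eta : ℂ)⁻¹) U) ∘ₗ (1 - (Gp ∘ₗ Qcs ∘ₗ Linv ∘ₗ Qc ∘ₗ Gp)) ∘ₗ conjHom b (divLin T ((g.eta : ℂ)⁻¹) U)) Qs a Q = 1)
    (hG : HasMajorant (g := toB6 g Rr H) (fun q : (κ × S) × ι => blk q.1.2) G
      (fun a a' => B₀ * g.len a ^ 2 * Real.exp (-(δ₀ * g.dist a a'))))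
    (hDG : ∀ k : κ ⊕ κ, HasMajorant (g := toB6 g Rr H) (fun q : (κ × S) × ι => blk q.1.2)
      (conj b (diffLetter (bT T) (bU U) ((g.eta : ℂ)⁻¹) k) * G) (fun a a' => B₀ * g.len a * Real.exp (-(δ₀ * g.dist a a'))))
    (hGD : ∀ k : κ ⊕ κ, HasMajorant (g := toB6 g Rr H) (fun q : (κ × S) × ι => blk q.1.2)
      (G * conj b (diffLetter (bT T) (bU U) ((g.eta : ℂ)⁻¹) k)) (fun a a' => B₀ * g.len a * Real.exp (-(δ₀ * g.dist a a'))))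
    -- (kernel form, FILE 28): Theorem 3.3's (3.42)₁,₂,₃,₄ for `G(U)` as PRINTED KERNEL BOUNDS (pairing weight `c = η^d`, volume weight `v(y′) = (L^j′ η)^d`)
    {v : g.Site → ℝ} (hv : ∀ y, 0 < v y) {c : ℝ} (hc : 0 < c)
    (hGk : HasKernelBound (g := toB6 g Rr H) (fun q : (κ × S) × ι => blk q.1.2) v c G
      (fun a a' => B₀ * g.len a ^ 2 * Real.exp (-(δ₀ * g.dist a a'))))
    (hDGk : ∀ k : κ ⊕ κ, HasKernelBound (g := toB6 g Rr H) (fun q : (κ × S) × ι => blk q.1.2) v c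
      (conj b (diffLetter (bT T) (bU U) ((g.eta : ℂ)⁻¹) k) * G) (fun a a' => B₀ * g.len a * Real.exp (-(δ₀ * g.dist a a'))))
    (hGDk : ∀ l : κ ⊕ κ, HasKernelBound (g := toB6 g Rr H) (fun q : (κ × S) × ι => blk q.1.2) v c
      (G * conj b (diffLetter (bT T) (bU U) ((g.eta : ℂ)⁻¹) l)) (fun a a' => B₀ * g.len a * Real.exp (-(δ₀ * g.dist a a'))))
    (hDGDk : ∀ k l : κ ⊕ κ, HasKernelBound (g := toB6 g Rr H) (fun q : (κ × S) × ι => blk q.1.2) v c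
      (conj b (diffLetter (bT T) (bU U) ((g.eta : ℂ)⁻¹) k) * G * conj b (diffLetter (bT T) (bU U) ((g.eta : ℂ)⁻¹) l)) (fun a a' => B₀ * Real.exp (-(δ₀ * g.dist a a'))))
    -- (FILE 34) Theorem 3.1/3.3's `B₀` is positive (p. 397 «positive constants M₁, δ₀, a₀, B₀»)
    (hB₀' : 0 < B₀) :
    ∃ a₁ : ℝ, 0 < a₁ ∧ ∃ B : ℝ, 0 ≤ B ∧
    ∀ (α₁ : ℝ), 0 ≤ α₁ → α₁ ≤ a₁ →
    -- the exponent field `A` in the domain (3.37), read blockwise in the shapes of FILES 1–19, and the `A`-dependent (3.59) data `kF`, `sF`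
    ∀ (A : κ → S → 𝔸) (kF : g.Site → S → 𝔸 →L[ℝ] 𝔸) (sF : S → 𝔸 →L[ℝ] 𝔸),
      (∀ y x, blk x = y → ‖kF y x‖ ≤ Cq * α₁ * w y) → (∀ x, ‖sF x‖ ≤ Cq * α₁) →
      (∀ ν k x, ‖((g.eta : ℂ)⁻¹) • covDstar T U ν (A k) x‖ ≤ α₁ * (g.len (blk x) ^ 2)⁻¹) →
      (∀ μ ν x, ‖((g.eta : ℂ)⁻¹) • covD T U μ (A ν) x‖ ≤ α₁ * (g.len (blk x) ^ 2)⁻¹) →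
      (∀ μ ν x, ‖((g.eta : ℂ)⁻¹) • covDstar T U ν (A ν) (T μ x)‖ ≤ α₁ * (g.len (blk x) ^ 2)⁻¹) →
      (∀ μ x, ‖((g.eta : ℂ)⁻¹) • covDstar T U μ (tauB T U μ (A μ)) x‖ ≤ α₁ * (g.len (blk x) ^ 2)⁻¹) →
      (∀ μ ν k x, ‖((g.eta : ℂ)⁻¹) • covD T U μ (A k) ((T ν).symm x)‖ ≤ α₁ * (g.len (blk x) ^ 2)⁻¹) →
      (∀ k x, ‖A k x‖ ≤ α₁ * (g.len (blk x))⁻¹) → (∀ ν k x, ‖tauB T U ν (A k) x‖ ≤ α₁ * (g.len (blk x))⁻¹) →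
      (∀ μ k x, ‖tauF T U μ (A k) x‖ ≤ α₁ * (g.len (blk x))⁻¹) →
      (∀ k μ ν x, ‖A k ((T ν).symm (T μ x))‖ ≤ α₁ * (g.len (blk x))⁻¹) →
      (∀ μ x m z, (m, z) ∈ stBonds T μ x → ‖A m z‖ ≤ α₁ * (g.len (blk x))⁻¹) →
      (∀ μ x m z, (m, z) ∈ B9Eq375Locality.locBondsA T μ x → ‖A m z‖ ≤ α₁ * (g.len (blk x))⁻¹) →
      (∀ μ x m n y, Through T μ x m n y →
        ‖covD T U m (A n) y‖ ≤ g.eta * (α₁ * ((g.len (blk x))⁻¹) ^ 2) ∧ ‖covD T U n (A m) y‖ ≤ g.eta * (α₁ * ((g.len (blk x))⁻¹) ^ 2)) →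
    -- the (3.57)/(3.59) letters `F′₂(A)`, `F′₂*(A)` (block-local, size `c_F α₁`)
    ∀ {Qc' Fc : (S × ι → ℝ) →ₗ[ℝ] (g.Site → ℝ)} {Qcs' Fcs : (g.Site → ℝ) →ₗ[ℝ] (S × ι → ℝ)},
      Qc' = Qc + Fc → Qcs' = Qcs + Fcs →
      HasMajorantHom (g := toB6 g Rr H) (fun p : S × ι => blk p.1) (fun y : g.Site => y) Fc
        (fun a a' : g.Site => cF * α₁ * (if a = a' then (1 : ℝ) else 0)) →
      HasMajorantHom (g := toB6 g Rr H) (fun y : g.Site => y) (fun p : S × ι => blk p.1) Fcs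
        (fun a a' : g.Site => cF * α₁ * (if a = a' then (1 : ℝ) else 0)) →
    -- the (3.80)–(3.81) letters `F₂(A)`, `F₂*(A)` («|F₂(A)|, |F₂*(A)| ≦ O(1)α₁»), `P₂(A)` of (3.82)
    ∀ {P₂ Qs' Q' F₂ F₂s : Module.End ℝ ((κ × S) × ι → ℝ)},
      Q' = Q + F₂ → Qs' = Qs + F₂s → P₂ = pTwo Qs Q F₂ F₂s a →
      HasMajorant (g := toB6 g Rr H) (fun q : (κ × S) × ι => blk q.1.2) F₂ (fun a a' => cFb * α₁ * Real.exp (-(δ₀ * g.dist a a'))) →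
      HasMajorant (g := toB6 g Rr H) (fun q : (κ × S) × ι => blk q.1.2) F₂s (fun a a' => cFb * α₁ * Real.exp (-(δ₀ * g.dist a a'))) →
      -- (i) `G′(U′U)`: the two-sided inverse of `Δ′_a(U) − V′(A)` (FILE 28, re-exported) and its Hölder-left members (FILE 34 §5, re-exported)
      (Δp - conj b (vPrimeConc T U g.eta A blk kQ kF sQ sF cfun)) * (gPrimeExtEnd Gp (conj b (vPrimeConc T U g.eta A blk kQ kF sQ sF cfun) * Gp)) = 1 ∧
      (gPrimeExtEnd Gp (conj b (vPrimeConc T U g.eta A blk kQ kF sQ sF cfun) * Gp)) * (Δp - conj b (vPrimeConc T U g.eta A blk kQ kF sQ sF cfun)) = 1 ∧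
      (∀ (D : Module.End ℝ (S × ι → ℝ)) (Φ : (S → 𝔸) →ₗ[ℝ] 𝔸) (y : g.Site) (p₀ : S × ι), blk p₀.1 = y →
        ∀ (β Bh cζ : ℝ), 0 ≤ Bh → 0 ≤ cζ →
        (∀ (y' : g.Site) (μ : S × ι → ℝ) (M : ℝ), BlockSupp (g := toB6 g Rr H) (fun p : S × ι => blk p.1) μ y' M →
          ‖Φ ((coordEquiv b).symm (D (Gp μ)))‖ ≤ Bh * g.len y ^ (1 - β) * cζ * Real.exp (-(δ₀ * g.dist y y')) * M) →
        ∀ (y' : g.Site) (μ : S × ι → ℝ) (M : ℝ), BlockSupp (g := toB6 g Rr H) (fun p : S × ι => blk p.1) μ y' M →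
          ‖Φ ((coordEquiv b).symm (D ((gPrimeExtEnd Gp (conj b (vPrimeConc T U g.eta A blk kQ kF sQ sF cfun) * Gp)) μ)))‖ ≤
            B * Bh * g.len y ^ (1 - β) * cζ * Real.exp (-(9 / 10 * δ₀ * g.dist y y')) * M) ∧
      -- (i′) NEW AT THIS LEVEL (FILE 34 §6 under the common threshold): the (3.43)-type member of `G′(U′U)` WITH THE DERIVATIVE ON THE RIGHT
      (∀ (D : Module.End ℝ (S × ι → ℝ)),
        HasMajorant (g := toB6 g Rr H) (fun p : S × ι => blk p.1) (Gp * D) (fun a a' => BG * g.len a * Real.exp (-(δ₀ * g.dist a a'))) →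
      ∀ (Φ : (S → 𝔸) →ₗ[ℝ] 𝔸) (y : g.Site) (p₀ : S × ι), blk p₀.1 = y →
      ∀ (β Bh cζ : ℝ), 0 ≤ Bh → 0 ≤ cζ →
        (∀ (y' : g.Site) (μ : S × ι → ℝ) (M : ℝ), BlockSupp (g := toB6 g Rr H) (fun p : S × ι => blk p.1) μ y' M →
          ‖Φ ((coordEquiv b).symm (Gp μ))‖ ≤ Bh * g.len y ^ (2 - β) * cζ * Real.exp (-(δ₀ * g.dist y y')) * M) →
        (∀ (k : κ ⊕ κ) (y' : g.Site) (μ : S × ι → ℝ) (M : ℝ), BlockSupp (g := toB6 g Rr H) (fun p : S × ι => blk p.1) μ y' M →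
          ‖Φ ((coordEquiv b).symm ((Gp * conj b (diffLetter T U ((g.eta : ℂ)⁻¹) k)) μ))‖ ≤
            Bh * g.len y ^ (1 - β) * cζ * Real.exp (-(δ₀ * g.dist y y')) * M) →
        (∀ (y' : g.Site) (μ : S × ι → ℝ) (M : ℝ), BlockSupp (g := toB6 g Rr H) (fun p : S × ι => blk p.1) μ y' M →
          ‖Φ ((coordEquiv b).symm ((Gp * D) μ))‖ ≤ Bh * g.len y ^ (1 - β) * cζ * Real.exp (-(δ₀ * g.dist y y')) * M) →
        ∀ (y' : g.Site) (μ : S × ι → ℝ) (M : ℝ), BlockSupp (g := toB6 g Rr H) (fun p : S × ι => blk p.1) μ y' M →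
          ‖Φ ((coordEquiv b).symm (((gPrimeExtEnd Gp (conj b (vPrimeConc T U g.eta A blk kQ kF sQ sF cfun) * Gp)) * D) μ))‖ ≤
            B * Bh * g.len y ^ (1 - β) * cζ * Real.exp (-(9 / 10 * δ₀ * g.dist y y')) * M) ∧
    ∃ (Tinv : Module.End ℝ (g.Site → ℝ)) (GExt : Module.End ℝ ((κ × S) × ι → ℝ)),
      -- (ii) `C⁻¹(U′U)` = THE two-sided inverse of `Q′(U′U)G′²(U′U)Q′*(U′U)` (FILE 28, re-exported)
      Tinv * (Qc' ∘ₗ ((gPrimeExtEnd Gp (conj b (vPrimeConc T U g.eta A blk kQ kF sQ sF cfun) * Gp)) * (gPrimeExtEnd Gp (conj b (vPrimeConc T U g.eta A blk kQ kF sQ sF cfun) * Gp))) ∘ₗ Qcs') = 1 ∧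
      (Qc' ∘ₗ ((gPrimeExtEnd Gp (conj b (vPrimeConc T U g.eta A blk kQ kF sQ sF cfun) * Gp)) * (gPrimeExtEnd Gp (conj b (vPrimeConc T U g.eta A blk kQ kF sQ sF cfun) * Gp))) ∘ₗ Qcs') * Tinv = 1 ∧
      -- (iii) `G(U′U)` = THE two-sided inverse of the concrete `Δ_a(U′U)` built with this `C⁻¹(U′U)` (FILE 28, re-exported) and its Hölder-left members (FILE 34 §5, re-exported)
      deltaA (conj b (lapDDLetter T ((g.eta : ℂ)⁻¹) (prodCfg U g.eta A)))
          (conj b (dPrimeLetter T (prodCfg U g.eta A) g.eta))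
          (conjHom b (gradLin T ((g.eta : ℂ)⁻¹) (prodCfg U g.eta A)) ∘ₗ (1 - ((Gp ∘ₗ Qcs ∘ₗ Linv ∘ₗ Qc ∘ₗ Gp) + (B9Eq360Vprime.pPrime Gp (gPrimeExtEnd Gp (conj b (vPrimeConc T U g.eta A blk kQ kF sQ sF cfun) * Gp)) (Qcs ∘ₗ secRes rep) (Qcs' ∘ₗ secRes rep) (secConj rep Linv) (secConj rep Tinv) (secExt rep ∘ₗ Qc) (secExt rep ∘ₗ Qc'))))
            ∘ₗ conjHom b (divLin T ((g.eta : ℂ)⁻¹) (prodCfg U g.eta A))) Qs' a Q' * GExt = 1 ∧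
      GExt *
      deltaA (conj b (lapDDLetter T ((g.eta : ℂ)⁻¹) (prodCfg U g.eta A)))
          (conj b (dPrimeLetter T (prodCfg U g.eta A) g.eta))
          (conjHom b (gradLin T ((g.eta : ℂ)⁻¹) (prodCfg U g.eta A)) ∘ₗ (1 - ((Gp ∘ₗ Qcs ∘ₗ Linv ∘ₗ Qc ∘ₗ Gp) + (B9Eq360Vprime.pPrime Gp (gPrimeExtEnd Gp (conj b (vPrimeConc T U g.eta A blk kQ kF sQ sF cfun) * Gp)) (Qcs ∘ₗ secRes rep) (Qcs' ∘ₗ secRes rep) (secConj rep Linv) (secConj rep Tinv) (secExt rep ∘ₗ Qc) (secExt rep ∘ₗ Qc'))))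
            ∘ₗ conjHom b (divLin T ((g.eta : ℂ)⁻¹) (prodCfg U g.eta A))) Qs' a Q' = 1 ∧
      (∀ (D : Module.End ℝ ((κ × S) × ι → ℝ)) (Φ : (κ × S → 𝔸) →ₗ[ℝ] 𝔸) (y : g.Site) (p₀ : (κ × S) × ι), blk p₀.1.2 = y →
        ∀ (β Bh cζ : ℝ), 0 ≤ Bh → 0 ≤ cζ →
        (∀ (y' : g.Site) (μ : (κ × S) × ι → ℝ) (M : ℝ), BlockSupp (g := toB6 g Rr H) (fun q : (κ × S) × ι => blk q.1.2) μ y' M →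
          ‖Φ ((coordEquiv b).symm (D (G μ)))‖ ≤ Bh * g.len y ^ (1 - β) * cζ * Real.exp (-(δ₀ * g.dist y y')) * M) →
        ∀ (y' : g.Site) (μ : (κ × S) × ι → ℝ) (M : ℝ), BlockSupp (g := toB6 g Rr H) (fun q : (κ × S) × ι => blk q.1.2) μ y' M →
          ‖Φ ((coordEquiv b).symm (D (GExt μ)))‖ ≤
            B * Bh * g.len y ^ (1 - β) * cζ * Real.exp (-(δ₀ / 6 * g.dist y y')) * M) ∧
      -- (iv) NEW: Theorem 3.3's (3.43)-type member of THIS `G(U′U)` WITH THE DERIVATIVE (any right letter `D_s` with a (3.42)₃-type entry) ON THE RIGHT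
      (∀ (Ds : Module.End ℝ ((κ × S) × ι → ℝ)),
        HasMajorant (g := toB6 g Rr H) (fun q : (κ × S) × ι => blk q.1.2) (G * Ds) (fun a a' => B₀ * g.len a * Real.exp (-(δ₀ * g.dist a a'))) →
      ∀ (Φ : (κ × S → 𝔸) →ₗ[ℝ] 𝔸) (y : g.Site) (p₀ : (κ × S) × ι), blk p₀.1.2 = y →
      ∀ (γ Bh cζ : ℝ), 0 ≤ Bh → 0 ≤ cζ →
        -- (a) the (3.40) quotient of `ζG(U)J` itself (from (3.42)₂ in print; an input here)
        (∀ (y' : g.Site) (μ : (κ × S) × ι → ℝ) (M : ℝ), BlockSupp (g := toB6 g Rr H) (fun q : (κ × S) × ι => blk q.1.2) μ y' M →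
          ‖Φ ((coordEquiv b).symm (G μ))‖ ≤ Bh * g.len y ^ (2 - γ) * cζ * Real.exp (-(δ₀ * g.dist y y')) * M) →
        -- (b) the member «‖ζG(U)∇_kJ‖_β» for every concrete difference letter
        (∀ (k : κ ⊕ κ) (y' : g.Site) (μ : (κ × S) × ι → ℝ) (M : ℝ), BlockSupp (g := toB6 g Rr H) (fun q : (κ × S) × ι => blk q.1.2) μ y' M →
          ‖Φ ((coordEquiv b).symm ((G * conj b (diffLetter (bT T) (bU U) ((g.eta : ℂ)⁻¹) k)) μ))‖ ≤
            Bh * g.len y ^ (1 - γ) * cζ * Real.exp (-(δ₀ * g.dist y y')) * M) →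
        -- (c) the member for the right letter `D_s`
        (∀ (y' : g.Site) (μ : (κ × S) × ι → ℝ) (M : ℝ), BlockSupp (g := toB6 g Rr H) (fun q : (κ × S) × ι => blk q.1.2) μ y' M →
          ‖Φ ((coordEquiv b).symm ((G * Ds) μ))‖ ≤ Bh * g.len y ^ (1 - γ) * cζ * Real.exp (-(δ₀ * g.dist y y')) * M) →
        ∀ (y' : g.Site) (μ : (κ × S) × ι → ℝ) (M : ℝ), BlockSupp (g := toB6 g Rr H) (fun q : (κ × S) × ι => blk q.1.2) μ y' M →
          ‖Φ ((coordEquiv b).symm ((GExt * Ds) μ))‖ ≤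
            B * Bh * g.len y ^ (1 - γ) * cζ * Real.exp (-(δ₀ / 6 * g.dist y y')) * M) := by
  classical
  obtain ⟨y₀⟩ := ‹Nonempty g.Site›
  -- FILE 34 §5 (identities + Hölder-left members), FILE 34 §6 (Hölder-right member of `G′(U′U)`), FILE 25 §3 ((3.77) with the printed quantifiers)
  obtain ⟨a₁, ha₁, B', hB', HL⟩ := thm34_all_holderLeft_final (Rr := Rr) (H := H) b T U blk d δ₀ B₀ κQ BG B₁ cF Cq a₀ C₀ d₀ M₂ κQb cFb
    abar kQ sQ cfun w hB₀ hκQ hBG hB₁ hcF hCq ha₀ hC₀ hM₂ hδ₀ hκQb hcFb habar hdnn htri hrefl hsym hlen hlenη hη hL h261 hST hrepr hT hU1 h35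
    hd₀B hd₀F hd₀FB hd₀st hd₀loc hd₀0 hw hcard hkQ hsQ hcfun h342_1 h342_2 h342_3 hΔpGp hGpΔp rep hrep hQc hQcs hLinv h348 hQb hQsb ha324 hΔG
    hGΔ hG hDG hGD hv hc hGk hDGk hGDk hDGDk hB₀'
  obtain ⟨a₃, ha₃, B₃, hB₃, HR⟩ := thm34_Gp_holderRight_final (Rr := Rr) (H := H) b T U blk d δ₀ BG Cq a₀ d₀ M₂ kQ sQ cfun w hBG hCq ha₀
    hM₂ hδ₀ hdnn htri hrefl hsym hlen hlenη hη h261 hST hrepr hU1 hd₀B hd₀F hd₀0 hw hcard hkQ hsQ hcfun hΔpGp hGpΔp h342_1 h342_2 h342_3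
  obtain ⟨a₂, ha₂, K, hK, H2⟩ := exists_threshold_pOne (Rr := Rr) (H := H) b T U blk d δ₀ κQ BG B₁ cF Cq a₀ d₀ M₂ kQ sQ cfun w hκQ hBG hB₁
    hcF hCq ha₀ hM₂ hδ₀ hdnn htri hrefl hsym hlen hlenη hη h261 hST hrepr hU1 hd₀B hd₀F hd₀0 hw hcard hkQ hsQ hcfun h342_1 h342_2 h342_3 rep
    hrep hQc hQcs hLinv h348
  -- the geometry of FILE 20's `G`-side cascade: exponents `1/100`, letters at the rate `δ₀/5`, composites at `9δ₀/50`, target `δ₀/6`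
  obtain ⟨Λ, hΛ, hT1, hT2, hT1i, hT2i, -, -⟩ := hST (1 / 100) (by norm_num)
  obtain ⟨Λρ, hΛρ1, hTρ0, -, -, -, -, -⟩ := hST (1 / 100 * (9 / 50)) (by norm_num)
  have hTρ : ScaleTransfer g (9 / 50 * δ₀) (1 / 100) Λρ (fun a => g.len a) := scaleTransfer_rescale hTρ0
  have hΛ0 : 0 ≤ Λ := zero_le_one.trans hΛ
  have hΛρ : 0 ≤ Λρ := zero_le_one.trans hΛρ1
  have h261β : Ineq261 d (toB6 g Rr H) δ₀ (1 / 100) := h261 _ (by norm_num) (by norm_num)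
  have h261' : Ineq261 d (toB6 g Rr H) (9 / 50 * δ₀) (1 / 100) :=
    ineq261_rescale (h261 (1 / 100 * (9 / 50)) (by norm_num) (by norm_num))
  have hc₂ : 0 < B6.c1 d δ₀ (1 / 100) := c1_pos_of_ineq261 h261β y₀ (hrefl y₀)
  have hδ5 : (0 : ℝ) ≤ 1 / 5 * δ₀ := by linarith only [hδ₀]
  have hρ0 : (0 : ℝ) ≤ 9 / 50 * δ₀ := by linarith only [hδ₀]
  have hr : 9 / 50 * δ₀ + (1 / 100 + 1 / 100) * δ₀ ≤ 1 / 5 * δ₀ := by linarith only [hδ₀]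
  have hrP : 1 / 5 * δ₀ + (1 / 100 + 1 / 100) * δ₀ ≤ δ₀ := by linarith only [hδ₀]
  have h15 : 1 / 5 * δ₀ ≤ δ₀ := by linarith only [hδ₀]
  have hα'ρ0 : (0 : ℝ) ≤ 1 / 100 * (9 / 50 * δ₀) := by linarith only [hδ₀]
  have hα'ρ2 : (0 : ℝ) ≤ (1 - 2 * (1 / 100)) * (9 / 50 * δ₀) := by linarith only [hδ₀]
  have hρ₃ : (0 : ℝ) ≤ δ₀ / 6 := by linarith only [hδ₀]
  have hρ₃' : δ₀ / 6 ≤ (1 - 3 * (1 / 100)) * (9 / 50 * δ₀) := by linarith only [hδ₀]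
  -- «for α₁ sufficiently small» (pp. 402, 407): the smallness function of (3.85)–(3.86) at this cascade is continuous at `α₁ = 0` and vanishes there
  obtain ⟨ε, hε, hF⟩ := exists_threshold_of_continuousAt
    (f := fun α₁ : ℝ => (kappa385 B₀ (cV385 (Fintype.card κ) α₁ C₀ (M₂ * (∑ i, ‖b i‖) * Real.exp (1 / 5 * δ₀ * d₀))
            + ∑ _k ∈ (Finset.univ : Finset (κ ⊕ κ)), (10 + 8 * Fintype.card κ + (16 * Fintype.card κ + 12) * C₀) * (M₂ * (∑ i, ‖b i‖) * Real.exp (1 / 5 * δ₀ * d₀))) K (kappa383 κQb cFb abar Λ (B6.c1 d δ₀ (1 / 100)) α₁) Λ (B6.c1 d δ₀ (1 / 100)) * α₁ * B6.c1 d (9 / 50 * δ₀) (1 / 100)))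
    (by
      unfold kappa385 kappa383 cV385 B9Eq382V3Letters.cV0 B9Eq373V3.kΔ B9Eq373V3.kP
      fun_prop)
    (by simp)
  -- «of course with different constants» (p. 403): the clause constant of FILE 35 at this cascade is continuous at `α₁ = 0`, hence bounded below a threshold
  obtain ⟨KB, εB, hKB, hεB, hFB⟩ := exists_bound_of_continuousAt
    (f := fun α₁ : ℝ => ((∑ i, ‖b i‖) * M₂ * (1 + kappa385 1 (cV385 (Fintype.card κ) α₁ C₀ (M₂ * (∑ i, ‖b i‖) * Real.exp (1 / 5 * δ₀ * d₀))
            + ∑ _k ∈ (Finset.univ : Finset (κ ⊕ κ)), (10 + 8 * Fintype.card κ + (16 * Fintype.card κ + 12) * C₀) * (M₂ * (∑ i, ‖b i‖) * Real.exp (1 / 5 * δ₀ * d₀))) K (kappa383 κQb cFb abar Λ (B6.c1 d δ₀ (1 / 100)) α₁) Λ (B6.c1 d δ₀ (1 / 100)) * α₁ * (B₀ * Λρ ^ 2 * B6.c1 d (9 / 50 * δ₀) (1 / 100) * (1 - (kappa385 B₀ (cV385 (Fintype.card κ) α₁ C₀ (M₂ * (∑ i, ‖b i‖) * Real.exp (1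 / 5 * δ₀ * d₀))
            + ∑ _k ∈ (Finset.univ : Finset (κ ⊕ κ)), (10 + 8 * Fintype.card κ + (16 * Fintype.card κ + 12) * C₀) * (M₂ * (∑ i, ‖b i‖) * Real.exp (1 / 5 * δ₀ * d₀))) K (kappa383 κQb cFb abar Λ (B6.c1 d δ₀ (1 / 100)) α₁) Λ (B6.c1 d δ₀ (1 / 100)) * α₁ * B6.c1 d (9 / 50 * δ₀) (1 / 100)))⁻¹) * Λρ * B6.c1 d (9 / 50 * δ₀) (1 / 100))))
    (by
      unfold kappa385 kappa383 cV385 B9Eq382V3Letters.cV0 B9Eq373V3.kΔ B9Eq373V3.kP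
      fun_prop (disch := simp))
  -- ONE threshold, ONE constant
  have hBtot : 0 ≤ B' + B₃ + KB := add_nonneg (add_nonneg hB' hB₃) hKB
  refine ⟨min (min (min a₁ a₂) (min a₃ (1 / 4))) (min (ε / 2) (εB / 2)),
    lt_min (lt_min (lt_min ha₁ ha₂) (lt_min ha₃ (by norm_num))) (lt_min (half_pos hε) (half_pos hεB)), B' + B₃ + KB, hBtot, ?_⟩
  intro α₁ hα₁0 hα₁1 A kF sF hkF hsF h337B h337F h337B' h337Bτ h337FB hA hAτB hAτF hAFB hAst hAloc hdAst Qc' Fc Qcs' Fcs h357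
    h357s hFc hFcs P₂ Qs' Q' F₂ F₂s h380 h380s hP₂def hF₂ hF₂s
  have hm₁ : min (min (min a₁ a₂) (min a₃ (1 / 4))) (min (ε / 2) (εB / 2)) ≤ a₁ :=
    (min_le_left _ _).trans ((min_le_left _ _).trans (min_le_left _ _))
  have hm₂ : min (min (min a₁ a₂) (min a₃ (1 / 4))) (min (ε / 2) (εB / 2)) ≤ a₂ :=
    (min_le_left _ _).trans ((min_le_left _ _).trans (min_le_right _ _))
  have hm₃ : min (min (min a₁ a₂) (min a₃ (1 / 4))) (min (ε / 2) (εB / 2)) ≤ a₃ :=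
    (min_le_left _ _).trans ((min_le_right _ _).trans (min_le_left _ _))
  have hmq : min (min (min a₁ a₂) (min a₃ (1 / 4))) (min (ε / 2) (εB / 2)) ≤ 1 / 4 :=
    (min_le_left _ _).trans ((min_le_right _ _).trans (min_le_right _ _))
  have hmε : min (min (min a₁ a₂) (min a₃ (1 / 4))) (min (ε / 2) (εB / 2)) ≤ ε / 2 := (min_le_right _ _).trans (min_le_left _ _)
  have hmεB : min (min (min a₁ a₂) (min a₃ (1 / 4))) (min (ε / 2) (εB / 2)) ≤ εB / 2 := (min_le_right _ _).trans (min_le_right _ _)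
  have hα₁a : α₁ ≤ a₁ := hα₁1.trans hm₁
  have hα₁b : α₁ ≤ a₂ := hα₁1.trans hm₂
  have hα₁c : α₁ ≤ a₃ := hα₁1.trans hm₃
  have hα₁q : α₁ ≤ 1 / 4 := hα₁1.trans hmq
  have habs : |α₁| = α₁ := abs_of_nonneg hα₁0
  have hα₁ε : |α₁| < ε := by rw [habs]; linarith only [hα₁1, hmε, hε]
  have hα₁εB : |α₁| < εB := by rw [habs]; linarith only [hα₁1, hmεB, hεB]
  -- FILE 34 §5 at this `α₁`, `A`: identities, `C⁻¹(U′U)`, `G(U′U)` and the two Hölder-left clauses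
  obtain ⟨i1, i2, hGpL, Tinv, GExt, e1, e2, e3, e4, hGL⟩ := HL α₁ hα₁0 hα₁a A kF sF hkF hsF h337B h337F h337B' h337Bτ h337FB hA hAτB
    hAτF hAFB hAst hAloc hdAst h357 h357s hFc hFcs h380 h380s hP₂def hF₂ hF₂s
  -- FILE 34 §6 at this `α₁`, `A`: the Hölder-right clause of `G′(U′U)`
  have hGpR := HR α₁ hα₁0 hα₁c A kF sF hkF hsF h337B h337F h337Bτ hA hAτB
  -- FILE 25 §3 at this `α₁`, `A`: ITS `C⁻¹(U′U)` coincides with FILE 28's (uniqueness of the two-sided inverse), so (3.77) holds for FILE 28's `P₁(A)`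
  obtain ⟨Tinv₂, f1, -, hP₁⟩ := H2 α₁ hα₁0 hα₁b A kF sF hkF hsF h337B h337F h337Bτ hA hAτB h357 h357s hFc hFcs
  have hTT : Tinv₂ = Tinv := left_inv_eq_right_inv f1 e2
  rw [hTT] at hP₁
  -- common non-negativities and the weakened constants
  have hw1 : ∀ a : g.Site, 0 ≤ g.len a := fun a => (hlen a).le
  have hw2 : ∀ a : g.Site, 0 ≤ g.len a ^ 2 := fun a => sq_nonneg _
  have hB'le : B' ≤ B' + B₃ + KB := by linarith only [hB₃, hKB]
  have hB₃le : B₃ ≤ B' + B₃ + KB := by linarith only [hB', hKB]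
  have hKBle : KB ≤ B' + B₃ + KB := by linarith only [hB', hB₃]
  refine ⟨i1, i2, ?_, ?_, Tinv, GExt, e1, e2, e3, e4, ?_, ?_⟩
  · -- (i) Hölder-left members of `G′(U′U)` (FILE 34 §5), constant weakened
    intro D Φ y p₀ hp₀ β Bh cζ hBh hcζ hhyp y' μ M hμ
    exact holderBound_const_mono hB'le hBh (Real.rpow_nonneg (hlen y).le _) hcζ (Real.exp_nonneg _) hμ.nonneg
      (hGpL D Φ y p₀ hp₀ β Bh cζ hBh hcζ hhyp y' μ M hμ)
  · -- (i′) Hölder-right member of `G′(U′U)` (FILE 34 §6), constant weakened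
    intro D hGpD Φ y p₀ hp₀ β Bh cζ hBh hcζ h0 hRk hD y' μ M hμ
    exact holderBound_const_mono hB₃le hBh (Real.rpow_nonneg (hlen y).le _) hcζ (Real.exp_nonneg _) hμ.nonneg
      (hGpR D hGpD Φ y p₀ hp₀ β Bh cζ hBh hcζ h0 hRk hD y' μ M hμ)
  · -- (iii) Hölder-left members of `G(U′U)` (FILE 34 §5), constant weakened
    intro D Φ y p₀ hp₀ β Bh cζ hBh hcζ hhyp y' μ M hμ
    exact holderBound_const_mono hB'le hBh (Real.rpow_nonneg (hlen y).le _) hcζ (Real.exp_nonneg _) hμ.nonneg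
      (hGL D Φ y p₀ hp₀ β Bh cζ hBh hcζ hhyp y' μ M hμ)
  · -- (iv) NEW: the Hölder-right member of THIS `G(U′U)` — FILE 35 at FILE 20's cascade, then uniqueness of the two-sided inverse
    intro Ds hGDs Φ y p₀ hp₀ γ Bh cζ hBh hcζ h0 hRk hD y' μ M hμ
    -- «η·α₁(Lʲη)⁻¹ ≦ 1/4» from `α₁ ≦ 1/4` and `η ≦ Lʲη`
    have hsmall : ∀ z : g.Site, g.eta * (α₁ * (g.len z)⁻¹) ≤ 1 / 4 := fun z => by
      have hq : g.eta * (g.len z)⁻¹ ≤ 1 := by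
        rw [← div_eq_mul_inv]; exact (div_le_one (hlen z)).mpr (hlenη z)
      calc g.eta * (α₁ * (g.len z)⁻¹) = α₁ * (g.eta * (g.len z)⁻¹) := by ring
        _ ≤ α₁ * 1 := mul_le_mul_of_nonneg_left hq hα₁0
        _ ≤ 1 / 4 := by linarith only [hα₁q]
    have hκ₂ : 0 ≤ (kappa383 κQb cFb abar Λ (B6.c1 d δ₀ (1 / 100)) α₁) := kappa383_nonneg hκQb hcFb habar hΛ0 hc₂.le hα₁0
    -- (3.83) for the printed `P₂(A)` at the rate `δ₀/5`
    have hP₂ : HasMajorant (g := toB6 g Rr H) (fun q : (κ × S) × ι => blk q.1.2) P₂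
        (fun a a' => (kappa383 κQb cFb abar Λ (B6.c1 d δ₀ (1 / 100)) α₁) * α₁ * (g.len a ^ 2)⁻¹ * Real.exp (-(1 / 5 * δ₀ * g.dist a a'))) := by
      rw [hP₂def]
      exact ineq383_op (R := Rr) (H := H) (fun q : (κ × S) × ι => blk q.1.2) d δ₀ δ₀ (1 / 100) (1 / 100) (1 / 5 * δ₀) Λ κQb cFb abar α₁ hκQb hcFb habar hα₁0 hΛ0
        hδ5 (by norm_num) (by norm_num) hδ₀.le hrP hdnn htri h261β hT2i hQb hQsb hF₂ hF₂s ha324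
    -- Theorem 3.3's letters for `U` weakened to the rate `δ₀/5`
    have hG5 := hasMajorant_rate_mono (R := Rr) (H := H) (fun q : (κ × S) × ι => blk q.1.2) B₀ (fun a => g.len a ^ 2) hB₀ hw2 h15 hdnn hG
    have hDG5 := fun k : κ ⊕ κ => hasMajorant_rate_mono (R := Rr) (H := H) (fun q : (κ × S) × ι => blk q.1.2) B₀ (fun a => g.len a) hB₀ hw1 h15 hdnn (hDG k)
    have hGD5 := fun k : κ ⊕ κ => hasMajorant_rate_mono (R := Rr) (H := H) (fun q : (κ × S) × ι => blk q.1.2) B₀ (fun a => g.len a) hB₀ hw1 h15 hdnn (hGD k)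
    have hGDs5 := hasMajorant_rate_mono (R := Rr) (H := H) (fun q : (κ × S) × ι => blk q.1.2) B₀ (fun a => g.len a) hB₀ hw1 h15 hdnn hGDs
    -- the smallness of (3.85)–(3.86) at this `α₁`
    have hsmall385 : (kappa385 B₀ (cV385 (Fintype.card κ) α₁ C₀ (M₂ * (∑ i, ‖b i‖) * Real.exp (1 / 5 * δ₀ * d₀))
            + ∑ _k ∈ (Finset.univ : Finset (κ ⊕ κ)), (10 + 8 * Fintype.card κ + (16 * Fintype.card κ + 12) * C₀) * (M₂ * (∑ i, ‖b i‖) * Real.exp (1 / 5 * δ₀ * d₀))) K (kappa383 κQb cFb abar Λ (B6.c1 d δ₀ (1 / 100)) α₁) Λ (B6.c1 d δ₀ (1 / 100)) * α₁ * B6.c1 d (9 / 50 * δ₀) (1 / 100)) < 1 := (hF α₁ hα₁ε).trans (by norm_num)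
    -- FILE 35: ONE MORE `G(U′U)` — two-sided inverse of THE SAME concrete `Δ_a(U′U)` — with the Hölder-right clause
    obtain ⟨GExt₂, -, g2, -, -, HRG⟩ := thm34_G_holderRight_concreteV₃ (Rr := Rr) (H := H) b T U blk d
      δ₀ (1 / 5 * δ₀) (1 / 100) (1 / 100) (9 / 50 * δ₀) (1 / 100) Λ Λρ B₀ K (kappa383 κQb cFb abar Λ (B6.c1 d δ₀ (1 / 100)) α₁) α₁ C₀ d₀ M₂
      hB₀ hK hκ₂ hα₁0 hC₀ hΛ0 hΛρ hρ0 (by norm_num) (by norm_num) hδ₀.le hδ5 hM₂ hr (by norm_num) hα'ρ0 hα'ρ2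
      hdnn htri hrefl hsym hlen h261β h261' hT1 hT2 hT1i hT2i hTρ hsmall385 hrepr hη hL A hT hsmall hU1
      h337B h337F h337B' h337Bτ h337FB hA hAτB hAτF hAFB hAst hAloc hdAst h35 hd₀B hd₀F hd₀FB hd₀st hd₀loc hd₀0
      (eq376_concrete T U b hη.ne' A (Gp ∘ₗ Qcs ∘ₗ Linv ∘ₗ Qc ∘ₗ Gp) (B9Eq360Vprime.pPrime Gp (gPrimeExtEnd Gp (conj b (vPrimeConc T U g.eta A blk kQ kF sQ sF cfun) * Gp)) (Qcs ∘ₗ secRes rep) (Qcs' ∘ₗ secRes rep) (secConj rep Linv) (secConj rep Tinv) (secExt rep ∘ₗ Qc) (secExt rep ∘ₗ Qc')))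
      h380 h380s hP₂def hΔG hGΔ hP₁ hP₂ hG5 hDG5 hGD5 hGDs5 (δ₀ / 6) hρ₃ hρ₃'
    have hGG : GExt₂ = GExt := left_inv_eq_right_inv g2 e3
    rw [hGG] at HRG
    -- the clause of FILE 35 fed with the inputs (a)–(c) read at the slower rate `δ₀/5`, then the constant bounded by `K_B ≦ B`
    have hℓ : 0 ≤ g.len y := (hlen y).le
    have key := HRG Φ y p₀ hp₀ γ Bh cζ hBh hcζ
      (fun z ν C hν => holderBound_rate_mono h15 (hdnn y z) hBh (Real.rpow_nonneg hℓ _) hcζ hν.nonneg (h0 z ν C hν))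
      (fun k z ν C hν => holderBound_rate_mono h15 (hdnn y z) hBh (Real.rpow_nonneg hℓ _) hcζ hν.nonneg (hRk k z ν C hν))
      (fun z ν C hν => holderBound_rate_mono h15 (hdnn y z) hBh (Real.rpow_nonneg hℓ _) hcζ hν.nonneg (hD z ν C hν)) y' μ M hμ
    exact holderBound_const_mono ((hFB α₁ hα₁εB).trans hKBle) hBh (Real.rpow_nonneg hℓ _) hcζ (Real.exp_nonneg _) hμ.nonneg key

end All

end Literature.MathematicalPhysics.QuantumFieldTheory.Balaban1983to89.B9Thm34HolderAllFinal

end
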